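import Summits.BirchSwinnertonDyer.BirchSwinnertonDyer.Theorems.ByReductionTypeAtTwoEulerCharFormalBound
import HarnessLib

/-!
# Route `ByReductionTypeAtTwo` (K4), TOWER road — Lemma 3.4 at layer `0`, the LOWER half, step 1:
# `#H¹(ℚ_v, Ê[p^k]) ≤ #(Ê(𝔪_∞)/(g−1))[p^∞] · #(E₁(ℚ_v)/p^k)` (Coates–Greenberg + evaluation injectivity + Kummer classes)

Cell `bsd-2adic`, seat `bsd-2adic-tower-1` (GEN 25), `--supports stmt-BirchSwinnertonDyer-19271` (helper). TOOL theorem only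
(no definition, no named fact, no `sorry`); closes nothing by itself; BSD is not proved by any of this. Part (f) of the
programme «Greenberg LNM 1716 Lemma 3.4 at layer `0` EXACT ⇒ Thm. 4.1 over `ℚ` ⇒ the `hEC` binder of the TOWER doors in the
kernel» (siblings `…EulerCharLayerZero/CoinvExact/CoinvInput/Devissage/ReductionCount/Assembly/FormalBound.lean`).

After `…EulerCharFormalBound` the exact count `#𝒦_{v,0}[p^∞] = (p^{ord_p #Ẽ(𝔽_p)})²` is reduced to the LOWER bound
`p^{ord_p #Ẽ(𝔽_p)} ≤ #(M₁/(g−1)M₁)[p^∞]` (`M₁ = Ê(𝔪̄)^{H_∞}`; Greenberg p. 89: `[Im λ_v : Im κ_v] = #H¹(ℚ_p, Ê(𝔪̄)) = #Ẽ(𝔽_p)_p`).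
Step 1 here (`natCard_H1_formalTorsion_le_mul`), step 2 in `…EulerCharFormalLower` (`#H²(Γ, Ê[p^k]) ≤ #(M₁/(g−1)M₁)[p^∞]`).

References: [GreenbergLNM1716] §2 Props. 2.2–2.4 (pp. 72–75), §3 Lemma 3.4 (p. 89); [CoatesGreenberg1996] Cor. 3.2;
[MilneADT2006] I Thm. 2.8; [SilvermanAEC2009] VII.2.1–2.2.
-/

set_option autoImplicit false
-- the Theorems namespace of this sub repeats the summit name by design (D-0017 nested layout: Summit.<S>.<Sub>)
set_option linter.dupNamespace false

noncomputable section

open scoped Classical NNReal ValuativeRel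

universe u

namespace Summit.BirchSwinnertonDyer.BirchSwinnertonDyer.Theorems.GoodOrdTower

open CategoryTheory NumberField IsDedekindDomain Field _root_.TopRep _root_.ContinuousCohomology
  Literature.NumberTheory.EllipticCurves Literature.NumberTheory.GaloisRepresentations IsDedekindDomain.HeightOneSpectrum
  Literature.NumberTheory.EllipticCurves.FormalGroupChart Literature.NumberTheory.EllipticCurves.ResKernel
  Literature.NumberTheory.EllipticCurves.Rank1Residual Literature.NumberTheory.EllipticCurves.CoatesGreenberg1996
  WeierstrassCurve Rat.HeightOneSpectrum

variable {p : ℕ} [hp : Fact p.Prime] {κ : ZpExtension ℚ p}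

set_option maxHeartbeats 6400000 in
/-- **`#H¹(Γ_{ℚ_v}, Ê[p^k]) ≤ #(Ê(𝔪_∞)/(g−1))[p^∞] · #(E₁(ℚ_v)/p^k E₁(ℚ_v))`** at the package level of
`…EulerCharAssembly` (`W/ℚ` globally minimal and elliptic with `GoodOrd W p`, `κ` cyclotomic, `v ∋ p`, `w` spectral, `red₀`
the reduction of `W_ℤ ⊗ 𝒪_w`, `g` generating `H_0 = Γ_{ℚ_v}` with `H_∞`, `M₁ = E(K̄_v)^{H_∞} ∩ ker red₀`, `D₁ = g − 1`), for
`Z = ker red₀ ∩ E(K̄_v)[p^k]` (`hZ`) and ANY continuous representation `ρ` of `Γ_{ℚ_v}` on `Z` acting as Galois (`hρ`);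
`E₁(ℚ_v) = ker red₀ ∩ E(K̄_v)^{H_0}`. Every class `[φ]` restricts on `H_∞` to the coboundary of a point `e` of the formal group
(Coates–Greenberg, `H1_goodModelKernel_trivial_holds`), giving the `p^k`-torsion class of `x_φ = φ(g) − (g e − e)` in
`M₁/(g−1)M₁`; two classes with the same image differ by the Kummer class of a point of `E₁(ℚ_v)` (evaluation injectivity
`exists_addMonoidHom_subgroupResKer_injective`, Hensel lift `exists_fixed_localRed_eq`), and the Kummer class only depends on
the point modulo `p^k E₁(ℚ_v)`; so `(y, ā) ↦ s(y) + κ(ā)` is onto `H¹`. [cite: GreenbergLNM1716, §3 Lemma 3.4 (p. 89); §2 pp.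
72–75] [cite: CoatesGreenberg1996, Cor. 3.2] -/
theorem natCard_H1_formalTorsion_le_mul (hκ : κ.IsCyclotomic) (v : HeightOneSpectrum (𝓞 ℚ))
    (hpv : ((p : ℕ) : 𝓞 ℚ) ∈ v.asIdeal) (W : WeierstrassCurve ℚ) [W.IsGloballyMinimal] [W.IsElliptic] (hgo : GoodOrd W p)
    {w : Valuation (AlgebraicClosure (v.adicCompletion ℚ)) ℝ≥0}
    (hw : ∀ x, (w x : ℝ) = spectralNorm (v.adicCompletion ℚ) (AlgebraicClosure (v.adicCompletion ℚ)) x)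
    (red₀ : localPoints W (v.adicCompletion ℚ) →+
      (((integralModelInt W).map (algebraMap ℤ ↥w.valuationSubring)).map
        (IsLocalRing.residue ↥w.valuationSubring)).toAffine.Point)
    (hred₀ : ∀ P : localPoints W (v.adicCompletion ℚ), red₀ P =
      ((integralModelInt W).map (algebraMap ℤ ↥w.valuationSubring)).reducePoint
        (Affine.Point.congrEquiv (localIntModel_baseChange W w.valuationSubring).symm P))
    {g : absoluteGaloisGroup (v.adicCompletion ℚ)}
    (hgen : ∀ U : Subgroup (absoluteGaloisGroup (v.adicCompletion ℚ)),
      IsOpen (U : Set (absoluteGaloisGroup (v.adicCompletion ℚ))) →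
        localSubgroup κ.kerSubgroup (v.adicCompletion ℚ) ≤ U → g ∈ U →
          localSubgroup (κ.layerSubgroup 0) (v.adicCompletion ℚ) ≤ U)
    (M₁ : AddSubgroup (localPoints W (v.adicCompletion ℚ)))
    (hM₁ : ∀ a, a ∈ M₁ ↔ a ∈ red₀.ker ∧ ∀ h ∈ localSubgroup κ.kerSubgroup (v.adicCompletion ℚ), h • a = a)
    (D₁ : M₁ →+ M₁) (hD₁ : ∀ a : M₁, ((D₁ a : M₁) : localPoints W (v.adicCompletion ℚ)) = g • (a : _) - a)
    [Finite (AddCommGroup.primaryComponent (M₁ ⧸ D₁.range) p)]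
    (k : ℕ) (Z : AddSubgroup (localPoints W (v.adicCompletion ℚ)))
    (hZ : ∀ a, a ∈ Z ↔ red₀ a = 0 ∧ p ^ k • a = 0)
    (ρ : ContinuousRep (absoluteGaloisGroup (v.adicCompletion ℚ)) ℤ Z)
    (hρ : ∀ (σ : absoluteGaloisGroup (v.adicCompletion ℚ)) (z : Z),
      ((ρ σ z : Z) : localPoints W (v.adicCompletion ℚ)) = σ • (z : localPoints W (v.adicCompletion ℚ)))
    [Finite (↥(red₀.ker ⊓ FixedPoints.addSubgroup (localSubgroup (κ.layerSubgroup 0) (v.adicCompletion ℚ)) (localPoints W (v.adicCompletion ℚ))) ⧸ (nsmulAddMonoidHom (p ^ k) : ↥(red₀.ker ⊓ FixedPoints.addSubgroup (localSubgroup (κ.layerSubgroup 0) (v.adicCompletion ℚ)) (localPoints W (v.adicCompletion ℚ))) →+ ↥(red₀.ker ⊓ FixedPoints.addSubgroup (localSubgroup (κ.layerSubgroup 0) (v.adicCompletion ℚ)) (localPoints W (v.adicCompletion ℚ)))).range)] :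
    Nat.card (continuousCohomology 1 ρ.toTopRep) ≤ Nat.card (AddCommGroup.primaryComponent (M₁ ⧸ D₁.range) p) *
      Nat.card (↥(red₀.ker ⊓ FixedPoints.addSubgroup (localSubgroup (κ.layerSubgroup 0) (v.adicCompletion ℚ)) (localPoints W (v.adicCompletion ℚ))) ⧸ (nsmulAddMonoidHom (p ^ k) : ↥(red₀.ker ⊓ FixedPoints.addSubgroup (localSubgroup (κ.layerSubgroup 0) (v.adicCompletion ℚ)) (localPoints W (v.adicCompletion ℚ))) →+ ↥(red₀.ker ⊓ FixedPoints.addSubgroup (localSubgroup (κ.layerSubgroup 0) (v.adicCompletion ℚ)) (localPoints W (v.adicCompletion ℚ)))).range) := by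
  -- notation and the local data (as in `…EulerCharFormalBound`)
  let K := v.adicCompletion ℚ
  let Pt : Type := localPoints W K
  let Γ := absoluteGaloisGroup K
  let Hi : Subgroup Γ := localSubgroup κ.kerSubgroup K
  let Qp := AddCommGroup.primaryComponent (M₁ ⧸ D₁.range) p
  haveI : CompactSpace Γ := absoluteGaloisGroup_compactSpace K
  have galois_smul_nsmul : ∀ (τ : Γ) (n : ℕ) (P : Pt), τ • (n • P) = n • (τ • P) :=
    fun τ n P ↦ map_nsmul (DistribSMul.toAddMonoidHom Pt τ) n P
  have hord : W.HasGoodReductionAtPrime p ∧ ¬ ((p : ℕ) : ℤ) ∣ W.frobeniusTrace p := hgo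
  have hΔ : ¬ ((p : ℕ) : ℤ) ∣ minimalDiscriminantInt W :=
    W.not_dvd_minimalDiscriminantInt_of_hasGoodReductionAtPrime' p hord.1
  have hap := hord.2
  have hvO : w.Integers w.valuationSubring := Valuation.valuationSubring.integers w
  have hΔu := W.isUnit_Δ_localIntModel hpv hw hΔ
  have hpO : w ((p : ℕ) : AlgebraicClosure K) < 1 := by
    have h := spectralValuation_algebraMap_ringOfIntegers_lt_one (v := v) hw hpv
    rwa [map_natCast] at h
  haveI hchar : CharP (IsLocalRing.ResidueField ↥w.valuationSubring) p := by
    refine (CharP.charP_iff_prime_eq_zero hp.out).mpr ?_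
    rw [← map_natCast (IsLocalRing.residue ↥w.valuationSubring), IsLocalRing.residue_eq_zero_iff,
      IsLocalRing.mem_maximalIdeal, mem_nonunits_iff, hvO.isUnit_iff_valuation_eq_one, map_natCast]
    exact ne_of_lt hpO
  haveI hV : (W.baseChange (AlgebraicClosure (v.adicCompletion ℚ))).IsIntegral w.integer :=
    ⟨⟨(integralModelInt W).map (algebraMap ℤ ↥w.integer), W.baseChange_eq_localIntModel_integer_baseChange⟩⟩
  obtain ⟨𝔐, h𝔐⟩ := v.localPrimesAbove_nonempty
  have hϖ : Irreducible ((p : ℕ) : v.adicCompletionIntegers ℚ) := irreducible_natCast_adicCompletionIntegers_rat hpv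
  obtain ⟨τ, hτ, hτfix⟩ := exists_isArithFrobAt_forall_smul_eq hw h𝔐 hpv hϖ
  have hτHi : τ ∈ Hi :=
    (mem_localSubgroup_iff _ _ τ).mpr (resGal_mem_kerSubgroup_of_forall_smul_rootOfUnity_eq hκ hτfix)
  have hordA := W.exists_zsmul_eq_zero_localRed_ne_zero hw hΔu red₀ hred₀ hpv hΔ hap
  obtain ⟨hgenr, -, hdiv₁⟩ := W.localRed_ordinary_filtration hΔu red₀ hred₀ hordA
  have hstab : ∀ (σ : Γ) (Q : Pt), red₀ Q = 0 → red₀ (σ • Q) = 0 :=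
    fun σ Q hQ ↦ (W.localRed_smul_eq_zero_iff hw hΔu red₀ hred₀ σ Q).mpr hQ
  have hker : ∀ Q : localPoints W (v.adicCompletion ℚ), red₀ Q = 0 ↔
      (Q : (W.baseChange (AlgebraicClosure (v.adicCompletion ℚ))).toAffine.Point) ∈
        kernel w (W.baseChange (AlgebraicClosure (v.adicCompletion ℚ))) := fun Q ↦
    W.localRed_eq_zero_iff_mem_kernel hΔu red₀ hred₀ Q
  haveI hHiN : Hi.Normal := by
    change (localSubgroup κ.kerSubgroup K).Normal
    rw [localSubgroup_eq_comap]; exact Subgroup.Normal.comap inferInstance _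
  have hmem0 : ∀ σ : Γ, σ ∈ localSubgroup (κ.layerSubgroup 0) K := fun σ ↦ by
    rw [mem_localSubgroup_iff, ZpExtension.layerSubgroup_zero]; exact Subgroup.mem_top _
  have hgen' : ∀ U : Subgroup Γ, IsOpen (U : Set Γ) → Hi ≤ U → g ∈ U → U = ⊤ := fun U hU hHU hgU ↦ by
    rw [eq_top_iff]; exact fun σ _ ↦ hgen U hU hHU hgU (hmem0 σ)
  have hcont : ∀ m : Pt, Continuous fun x : Γ ↦ x • m := fun m ↦ continuous_smul_localPoints W K m
  -- iterated `p`-divisibility of `A₁`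
  have hdivpow : ∀ (j : ℕ) (a : Pt), red₀ a = 0 → ∃ b : Pt, red₀ b = 0 ∧ p ^ j • b = a := by
    intro j
    induction j with
    | zero => exact fun a ha ↦ ⟨a, ha, by rw [pow_zero, one_smul]⟩
    | succ j ih =>
      intro a ha
      obtain ⟨b, hb, rfl⟩ := hdiv₁ a ha
      obtain ⟨c, hc, rfl⟩ := ih b hb
      exact ⟨c, hc, by rw [pow_succ, mul_comm, mul_smul]⟩
  -- Coates–Greenberg on `H_∞` for the good model `W_ℤ ⊗ 𝒪_w` (as in `…CoinvInput`)
  let W₀ : WeierstrassCurve w.integer := (integralModelInt W).map (algebraMap ℤ ↥w.valuationSubring)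
  have hΔ' : IsUnit W₀.Δ := hΔu
  have e₁ : W₀.baseChange (AlgebraicClosure K) = W.baseChange (AlgebraicClosure K) :=
    localIntModel_baseChange W w.valuationSubring
  have hW₀ : (1 : VariableChange (AlgebraicClosure K)) • (W.baseChange K).baseChange (AlgebraicClosure K) =
      W₀.baseChange (AlgebraicClosure K) := by
    rw [one_smul, baseChange_baseChange_adicCompletion, e₁]
  have hred : ∀ P : Pt, red₀ P = goodReductionHom W₀ (Valuation.integer.integers w) hΔ'
      (Affine.Point.congrEquiv hW₀ (VariableChange.pointEquiv _ 1
        (Affine.Point.congrEquiv (baseChange_baseChange_adicCompletion W v).symm P))) := by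
    intro P
    rw [hred₀ P, goodReductionHom_apply]
    congr 1
    change (W.baseChange (AlgebraicClosure K)).toAffine.Point at P
    rcases P with _ | ⟨x, y, hP⟩
    · simp only [← Affine.Point.zero_def, map_zero]
      rfl
    · simp only [Affine.Point.congrEquiv_some, VariableChange.pointEquiv_some]
      exact point_some_congr (toX_one x).symm (toY_one x y).symm
  have hmem1 : ∀ P : Pt, red₀ P = 0 → Affine.Point.congrEquiv hW₀ (VariableChange.pointEquiv _ 1
      (Affine.Point.congrEquiv (baseChange_baseChange_adicCompletion W v).symm P)) ∈
        kernelOfReduction W₀ (Valuation.integer.integers w) := fun P hP ↦ by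
    rw [mem_kernelOfReduction_iff, ← goodReductionHom_eq_zero_iff (Valuation.integer.integers w) hΔ', ← hred]
    exact hP
  have hmem2 : ∀ P : Pt, Affine.Point.congrEquiv hW₀ (VariableChange.pointEquiv _ 1
      (Affine.Point.congrEquiv (baseChange_baseChange_adicCompletion W v).symm P)) ∈
        kernelOfReduction W₀ (Valuation.integer.integers w) → red₀ P = 0 := fun P hP ↦ by
    rw [mem_kernelOfReduction_iff, ← goodReductionHom_eq_zero_iff (Valuation.integer.integers w) hΔ', ← hred] at hP
    exact hP
  have hGc : IsClosed ((Hi : Set Γ)) := κ.isClosed_kerSubgroup.preimage (map_continuous (resGal (K := ℚ) K))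
  have hGC : ∀ σ ∈ Hi, (1 : VariableChange (AlgebraicClosure K)).map
      ((absoluteGaloisGroup.toAlgEquiv K σ : AlgebraicClosure K ≃ₐ[K] AlgebraicClosure K) :
        AlgebraicClosure K →+* AlgebraicClosure K) = 1 :=
    fun σ _ ↦ (VariableChange.mapHom _).map_one
  have hCG_Hi : ∀ ψ : contOneCocycles (discreteTopRep Hi Pt), (∀ h, red₀ (ψ.1 h) = 0) →
      ∃ e : Pt, red₀ e = 0 ∧ ∀ h : Hi, ψ.1 h = (h : Γ) • e - e := by
    intro ψ hψ
    obtain ⟨e, he, hφe⟩ := H1_goodModelKernel_trivial_holds ℚ W p κ hκ v hpv w hw 1 W₀ hW₀ hΔ' Hi hGc le_rfl hGC ψ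
      (fun h ↦ hmem1 _ (hψ h))
    exact ⟨e, hmem2 e he, fun h ↦ hφe h⟩
  -- from a class of `H¹(Γ, Z)`: a representative, the Coates–Greenberg point `e`, the point `x_φ ∈ M₁`
  have hρΓ : ∀ (σ : Γ) (z : Z), (((ρ.toTopRep).ρ σ z : Z) : Pt) = σ • (z : Pt) := fun σ z ↦ hρ σ z
  have key : ∀ φ : contOneCocycles ρ.toTopRep, ∃ e : Pt, red₀ e = 0 ∧
      (∀ h : Hi, ((φ.1 (h : Γ) : Z) : Pt) = (h : Γ) • e - e) := by
    intro φ
    let ψ' : contOneCocycles (discreteTopRep Hi Pt) :=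
      ⟨⟨fun h ↦ ((φ.1 (h : Γ) : Z) : Pt), continuous_subtype_val.comp (φ.1.continuous.comp continuous_subtype_val)⟩,
        fun σ σ' ↦ by
          change ((φ.1 ((σ : Γ) * (σ' : Γ)) : Z) : Pt) = ((φ.1 (σ : Γ) : Z) : Pt) + (σ : Γ) • ((φ.1 (σ' : Γ) : Z) : Pt)
          rw [φ.2 (σ : Γ) (σ' : Γ), AddSubgroup.coe_add, hρΓ]⟩
    obtain ⟨e, he0, he⟩ := hCG_Hi ψ' (fun h ↦ ((hZ _).mp (φ.1 (h : Γ)).2).1)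
    exact ⟨e, he0, fun h ↦ he h⟩
  choose eφ heφ0 heφ using key
  -- `x_φ := φ(g) − (g e − e)` lies in `M₁` and `p^k x_φ = −(g−1)(p^k e)` with `p^k e ∈ M₁`
  let xφ : contOneCocycles ρ.toTopRep → Pt := fun φ ↦ ((φ.1 g : Z) : Pt) - (g • eφ φ - eφ φ)
  -- the cocycle `c_φ = φ − ∂e` on `Γ`, vanishing on `H_∞`
  have hcφ : ∀ φ : contOneCocycles ρ.toTopRep, ∃ c : contOneCocycles (discreteTopRep Γ Pt),
      (∀ σ, c.1 σ = ((φ.1 σ : Z) : Pt) - (σ • eφ φ - eφ φ)) ∧ (∀ h ∈ Hi, c.1 h = 0) := by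
    intro φ
    refine ⟨⟨⟨fun σ ↦ ((φ.1 σ : Z) : Pt) - (σ • eφ φ - eφ φ),
      (continuous_subtype_val.comp φ.1.continuous).sub ((hcont (eφ φ)).sub continuous_const)⟩, fun σ σ' ↦ ?_⟩,
      fun σ ↦ rfl, fun h hh ↦ ?_⟩
    · change ((φ.1 (σ * σ') : Z) : Pt) - ((σ * σ') • eφ φ - eφ φ) =
        (((φ.1 σ : Z) : Pt) - (σ • eφ φ - eφ φ)) + σ • (((φ.1 σ' : Z) : Pt) - (σ' • eφ φ - eφ φ))
      rw [φ.2 σ σ', AddSubgroup.coe_add, hρΓ, mul_smul, smul_sub, smul_sub]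
      abel
    · change ((φ.1 h : Z) : Pt) - (h • eφ φ - eφ φ) = 0
      rw [heφ φ ⟨h, hh⟩, sub_self]
  choose cφ hcφv hcφN using hcφ
  have hxφM : ∀ φ, xφ φ ∈ M₁ := by
    intro φ
    refine (hM₁ _).mpr ⟨(AddMonoidHom.mem_ker).mpr ?_, fun h hh ↦ ?_⟩
    · change red₀ (((φ.1 g : Z) : Pt) - (g • eφ φ - eφ φ)) = 0
      rw [map_sub, map_sub, ((hZ _).mp (φ.1 g).2).1, hstab g _ (heφ0 φ), heφ0 φ, sub_zero, sub_zero]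
    · have h1 := apply_mem_fixedPoints Hi Pt (cφ φ) (hcφN φ) g
      rw [hcφv] at h1
      exact (FixedPoints.mem_addSubgroup _ _ _).mp h1 ⟨h, hh⟩
  have hpkE : ∀ φ, p ^ k • eφ φ ∈ M₁ := by
    intro φ
    refine (hM₁ _).mpr ⟨(AddMonoidHom.mem_ker).mpr (by rw [map_nsmul, heφ0, nsmul_zero]), fun h hh ↦ ?_⟩
    rw [galois_smul_nsmul, ← sub_eq_zero, ← smul_sub, ← heφ φ ⟨h, hh⟩]
    exact ((hZ _).mp (φ.1 _).2).2
  have hpkx : ∀ φ, p ^ k • (⟨xφ φ, hxφM φ⟩ : M₁) = -(D₁ ⟨p ^ k • eφ φ, hpkE φ⟩) := by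
    intro φ
    apply Subtype.ext
    rw [AddSubgroup.coe_nsmul, AddSubgroup.coe_neg, hD₁]
    change p ^ k • (((φ.1 g : Z) : Pt) - (g • eφ φ - eφ φ)) = -(g • (p ^ k • eφ φ) - p ^ k • eφ φ)
    rw [smul_sub, ((hZ _).mp (φ.1 g).2).2, zero_sub, smul_sub, galois_smul_nsmul]
  -- the map `Ψ : H¹(Γ, Z) → (M₁/D₁M₁)[p^∞]`
  let repr : continuousCohomology 1 ρ.toTopRep → contOneCocycles ρ.toTopRep :=
    fun x ↦ (oneCocycleClass_surjective _ x).choose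
  have hrepr : ∀ x, oneCocycleClass _ (repr x) = x := fun x ↦ (oneCocycleClass_surjective _ x).choose_spec
  let Ψ₀ : contOneCocycles ρ.toTopRep → Qp := fun φ ↦ ⟨QuotientAddGroup.mk ⟨xφ φ, hxφM φ⟩,
    (AddCommGroup.mem_primaryComponent).mpr ⟨k, by
      rw [← QuotientAddGroup.mk_nsmul, hpkx, QuotientAddGroup.eq_zero_iff]
      exact neg_mem ⟨_, rfl⟩⟩⟩
  let Ψ : continuousCohomology 1 ρ.toTopRep → Qp := fun x ↦ Ψ₀ (repr x)
  -- the Kummer classes of `A₀ = E₁(ℚ_v)`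
  let A₀ : AddSubgroup (localPoints W (v.adicCompletion ℚ)) :=
    red₀.ker ⊓ FixedPoints.addSubgroup (localSubgroup (κ.layerSubgroup 0) (v.adicCompletion ℚ)) (localPoints W (v.adicCompletion ℚ))
  have hA₀ : ∀ a, a ∈ A₀ ↔ a ∈ red₀.ker ∧ ∀ σ ∈ localSubgroup (κ.layerSubgroup 0) (v.adicCompletion ℚ), σ • a = a :=
      fun a ↦ by
    change a ∈ red₀.ker ⊓ FixedPoints.addSubgroup _ (localPoints W (v.adicCompletion ℚ)) ↔ _
    rw [AddSubgroup.mem_inf, FixedPoints.mem_addSubgroup]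
    exact ⟨fun ⟨h1, h2⟩ ↦ ⟨h1, fun σ hσ ↦ h2 ⟨σ, hσ⟩⟩, fun ⟨h1, h2⟩ ↦ ⟨h1, fun σ ↦ h2 σ σ.2⟩⟩
  have hA₀fix : ∀ a ∈ A₀, ∀ σ : Γ, σ • a = a := fun a ha σ ↦ ((hA₀ a).mp ha).2 σ (hmem0 σ)
  -- Kummer cocycle of `b` with `p^k b ∈ A₀`, `red₀ b = 0`
  have kum : ∀ b : Pt, red₀ b = 0 → (∀ σ : Γ, σ • (p ^ k • b) = p ^ k • b) →
      ∃ s : contOneCocycles ρ.toTopRep, ∀ σ, ((s.1 σ : Z) : Pt) = σ • b - b := by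
    intro b hb0 hbfix
    have hsmem : ∀ σ : Γ, σ • b - b ∈ Z := fun σ ↦ (hZ _).mpr
      ⟨by rw [map_sub, hstab σ b hb0, hb0, sub_zero], by rw [smul_sub, ← galois_smul_nsmul, hbfix σ, sub_self]⟩
    have hscont : Continuous fun σ : Γ ↦ (⟨σ • b - b, hsmem σ⟩ : Z) :=
      ((continuous_of_discreteTopology (f := fun q : Pt ↦ q - b)).comp (hcont b)).subtype_mk _
    refine ⟨⟨⟨fun σ ↦ ⟨σ • b - b, hsmem σ⟩, hscont⟩, fun σ σ' ↦ ?_⟩, fun σ ↦ rfl⟩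
    apply Subtype.ext
    rw [AddSubgroup.coe_add, hρΓ]
    change (σ * σ') • b - b = (σ • b - b) + σ • (σ' • b - b)
    rw [mul_smul, smul_sub]
    abel
  -- two cocycles with the same `Pt`-values as Kummer cocycles of points differing by `Z` have the same class
  have hclass : ∀ (s s' : contOneCocycles ρ.toTopRep) (z : Pt) (hz : z ∈ Z),
      (∀ σ, ((s.1 σ : Z) : Pt) - ((s'.1 σ : Z) : Pt) = σ • z - z) →
      oneCocycleClass _ s = oneCocycleClass _ s' := by
    intro s s' z hz h
    rw [← sub_eq_zero, ← oneCocycleClass_sub, oneCocycleClass_eq_zero_iff]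
    refine ⟨⟨z, hz⟩, fun σ ↦ Subtype.ext ?_⟩
    change ((s.1 σ : Z) : Pt) - ((s'.1 σ : Z) : Pt) = ((ρ.toTopRep.ρ σ ⟨z, hz⟩ : Z) : Pt) - z
    rw [hρΓ, h σ]
  -- `κ : A₀ → H¹(Γ, Z)` through chosen roots
  have hroot : ∀ a : A₀, ∃ b : Pt, red₀ b = 0 ∧ p ^ k • b = a := fun a ↦
    hdivpow k (a : Pt) ((AddMonoidHom.mem_ker).mp ((hA₀ _).mp a.2).1)
  choose root hroot0 hrootk using hroot
  have hrootfix : ∀ a : A₀, ∀ σ : Γ, σ • (p ^ k • root a) = p ^ k • root a := fun a σ ↦ by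
    rw [hrootk]; exact hA₀fix _ a.2 σ
  choose κs hκs using fun a : A₀ ↦ kum (root a) (hroot0 a) (hrootfix a)
  let κA : A₀ → continuousCohomology 1 ρ.toTopRep := fun a ↦ oneCocycleClass _ (κs a)
  -- `κ` only depends on the class modulo `p^k A₀`
  have hκA : ∀ a a' : A₀, (a : Pt) - a' ∈ (nsmulAddMonoidHom (p ^ k) : A₀ →+ A₀).range.map A₀.subtype →
      κA a = κA a' := by
    rintro a a' ⟨_, ⟨c, rfl⟩, hc⟩
    change (((p ^ k • c : A₀)) : Pt) = (a : Pt) - a' at hc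
    refine hclass _ _ (root a - root a' - (c : Pt)) ((hZ _).mpr ⟨?_, ?_⟩) fun σ ↦ ?_
    · rw [map_sub, map_sub, hroot0, hroot0, (AddMonoidHom.mem_ker).mp ((hA₀ _).mp c.2).1, sub_zero, sub_zero]
    · rw [smul_sub, smul_sub, hrootk, hrootk, ← AddSubgroupClass.coe_nsmul, hc, sub_self]
    · rw [hκs, hκs, smul_sub, smul_sub, hA₀fix _ c.2 σ]
      abel
  -- the fibre property: `Ψ x = Ψ x' ⟹ x − x' = κ a₀` for some `a₀ ∈ A₀`
  obtain ⟨wv, hwinj, hwval⟩ := exists_addMonoidHom_subgroupResKer_injective Hi Pt g hgen' hcont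
  have hfib : ∀ x x' : continuousCohomology 1 ρ.toTopRep, Ψ x = Ψ x' → ∃ a₀ : A₀, x - x' = κA a₀ := by
    intro x x' hxx
    set φ := repr x
    set φ' := repr x'
    have hq : (QuotientAddGroup.mk ⟨xφ φ, hxφM φ⟩ : M₁ ⧸ D₁.range) = QuotientAddGroup.mk ⟨xφ φ', hxφM φ'⟩ :=
      congrArg (fun q : Qp ↦ (q : M₁ ⧸ D₁.range)) hxx
    rw [QuotientAddGroup.eq_iff_sub_mem] at hq
    obtain ⟨m₁, hm₁⟩ := hq
    have hm₁' : g • (m₁ : Pt) - m₁ = xφ φ - xφ φ' := by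
      have h := congrArg (fun y : M₁ ↦ (y : Pt)) hm₁
      simp only [hD₁, AddSubgroup.coe_sub] at h
      exact h
    have hm₁fix : ∀ h ∈ Hi, h • (m₁ : Pt) = m₁ := ((hM₁ _).mp m₁.2).2
    have hm₁red : red₀ (m₁ : Pt) = 0 := (AddMonoidHom.mem_ker).mp ((hM₁ _).mp m₁.2).1
    -- `θ = c_φ − c_φ' − ∂m₁` vanishes on `H_∞` and at `g`, hence is a coboundary `∂q`
    let θ : contOneCocycles (discreteTopRep Γ Pt) := cφ φ - cφ φ' -
      ⟨⟨fun σ ↦ σ • (m₁ : Pt) - m₁, (hcont (m₁ : Pt)).sub continuous_const⟩, fun σ σ' ↦ by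
        change (σ * σ') • (m₁ : Pt) - m₁ = (σ • (m₁ : Pt) - m₁) + σ • (σ' • (m₁ : Pt) - m₁)
        rw [mul_smul, smul_sub]; abel⟩
    have hθv : ∀ σ, θ.1 σ = (cφ φ).1 σ - (cφ φ').1 σ - (σ • (m₁ : Pt) - m₁) := fun σ ↦ rfl
    have hθN : ∀ h ∈ Hi, θ.1 h = 0 := fun h hh ↦ by
      rw [hθv, hcφN φ h hh, hcφN φ' h hh, hm₁fix h hh, sub_self, sub_self, sub_self]
    have hθg : θ.1 g = 0 := by
      rw [hθv, hcφv, hcφv, hm₁']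
      change xφ φ - xφ φ' - (xφ φ - xφ φ') = 0
      rw [sub_self]
    have hmem : oneCocycleClass _ θ ∈ subgroupResKer Pt Hi := by
      rw [mem_subgroupResKer_iff, ResKernel.resSubgroup_oneCocycleClass]
      have h0 : contOneCocycles.pullback (Literature.NumberTheory.EllipticCurves.subgroupIncl Hi)
          (resHomOfEquivariant (Literature.NumberTheory.EllipticCurves.subgroupIncl Hi) (AddMonoidHom.id Pt)
            (fun _ _ ↦ rfl)) θ = 0 := by
        apply Subtype.ext
        ext n
        rw [pullback_subtype_apply]
        exact hθN n n.2
      rw [h0, oneCocycleClass_zero]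
    have hzero : (⟨_, hmem⟩ : subgroupResKer Pt Hi) = 0 := by
      apply hwinj
      rw [map_zero, hwval ⟨_, hmem⟩ θ hθN rfl, QuotientAddGroup.eq_zero_iff]
      exact ⟨0, Subtype.ext (by rw [map_zero]; exact hθg.symm)⟩
    have hθ0 : oneCocycleClass _ θ = 0 := congrArg (fun z : subgroupResKer Pt Hi ↦ (z : discreteH1 Γ Pt)) hzero
    obtain ⟨q, hq'⟩ := (oneCocycleClass_eq_zero_iff _ _).mp hθ0
    have hq : ∀ σ : Γ, θ.1 σ = σ • q - q := fun σ ↦ hq' σ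
    -- `b = e − e' + m₁ + q`: `(φ − φ')(σ) = σ b − b`
    have hφσ : ∀ σ : Γ, ((φ.1 σ : Z) : Pt) - ((φ'.1 σ : Z) : Pt) =
        σ • (eφ φ - eφ φ' + m₁ + q) - (eφ φ - eφ φ' + m₁ + q) := by
      intro σ
      have h := hq σ
      rw [hθv, hcφv, hcφv] at h
      have h2 : ((φ.1 σ : Z) : Pt) - ((φ'.1 σ : Z) : Pt) =
          (σ • q - q) + (σ • eφ φ - eφ φ) - (σ • eφ φ' - eφ φ') + (σ • (m₁ : Pt) - m₁) := by
        rw [← h]; abel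
      rw [h2, smul_add, smul_add, smul_sub]
      abel
    -- the reduction of `q` is Frobenius-fixed: replace `q` by `q − q₀` with `q₀` rational
    have hredq : ∀ σ : Γ, red₀ (σ • q) = red₀ q := by
      intro σ
      have h := hq σ
      rw [hθv, hcφv, hcφv] at h
      have hA : red₀ (θ.1 σ) = 0 := by
        rw [hθv, hcφv, hcφv, map_sub, map_sub, map_sub, map_sub, map_sub, map_sub, map_sub,
          ((hZ _).mp (φ.1 σ).2).1, ((hZ _).mp (φ'.1 σ).2).1, hstab σ _ (heφ0 φ), heφ0 φ,
          hstab σ _ (heφ0 φ'), heφ0 φ', hstab σ _ hm₁red, hm₁red]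
        simp
      rw [hq σ, map_sub, sub_eq_zero] at hA
      exact hA
    obtain ⟨q₀, hq₀fix, hq₀⟩ := exists_fixed_localRed_eq W hw hΔu red₀ hred₀ hpv hΔ h𝔐 hτ q (hredq τ)
    set b : Pt := eφ φ - eφ φ' + m₁ + q - q₀ with hb
    have hbσ : ∀ σ : Γ, ((φ.1 σ : Z) : Pt) - ((φ'.1 σ : Z) : Pt) = σ • b - b := fun σ ↦ by
      rw [hb, smul_sub σ _ q₀, hq₀fix σ, hφσ σ]; abel
    have hb0 : red₀ b = 0 := by
      rw [hb, map_sub, map_add, map_add, map_sub, heφ0, heφ0, hm₁red, hq₀]; simp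
    have hbk : ∀ σ : Γ, σ • (p ^ k • b) = p ^ k • b := fun σ ↦ by
      rw [galois_smul_nsmul, ← sub_eq_zero, ← smul_sub, ← hbσ σ, smul_sub, ((hZ _).mp (φ.1 σ).2).2,
        ((hZ _).mp (φ'.1 σ).2).2, sub_self]
    have ha₀ : p ^ k • b ∈ A₀ := (hA₀ _).mpr ⟨(AddMonoidHom.mem_ker).mpr (by rw [map_nsmul, hb0, nsmul_zero]),
      fun σ _ ↦ hbk σ⟩
    refine ⟨⟨p ^ k • b, ha₀⟩, ?_⟩
    -- `x − x' = [φ − φ'] = κ(p^k b)`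
    have hx : x - x' = oneCocycleClass _ (φ - φ') := by rw [oneCocycleClass_sub, hrepr, hrepr]
    rw [hx]
    refine hclass _ _ (b - root ⟨p ^ k • b, ha₀⟩) ((hZ _).mpr ⟨?_, ?_⟩) fun σ ↦ ?_
    · rw [map_sub, hb0, hroot0, sub_zero]
    · rw [smul_sub, hrootk, sub_self]
    · rw [hκs]
      change ((φ.1 σ : Z) : Pt) - ((φ'.1 σ : Z) : Pt) - (σ • root ⟨p ^ k • b, ha₀⟩ - root ⟨p ^ k • b, ha₀⟩) = _
      rw [hbσ σ, smul_sub σ b (root ⟨p ^ k • b, ha₀⟩)]; abel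
  -- `#H¹ ≤ #Qp · #(A₀/p^k)`: the map `(y, ā) ↦ s(y) + κ(ā.out)` is onto
  let A0bar := A₀ ⧸ (nsmulAddMonoidHom (p ^ k) : A₀ →+ A₀).range
  haveI : Finite Qp := inferInstance
  let sec : Qp → continuousCohomology 1 ρ.toTopRep := fun y ↦
    if h : ∃ x, Ψ x = y then h.choose else 0
  let Λ : Qp × A0bar → continuousCohomology 1 ρ.toTopRep := fun ya ↦ sec ya.1 + κA (Quotient.out ya.2)
  have hΛ : Function.Surjective Λ := by
    intro x
    have hy : ∃ x', Ψ x' = Ψ x := ⟨x, rfl⟩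
    have hsec : Ψ (sec (Ψ x)) = Ψ x := by
      change Ψ (if h : ∃ x', Ψ x' = Ψ x then h.choose else 0) = Ψ x
      rw [dif_pos hy]; exact hy.choose_spec
    obtain ⟨a₀, ha₀⟩ := hfib x (sec (Ψ x)) hsec.symm
    refine ⟨(Ψ x, QuotientAddGroup.mk a₀), ?_⟩
    change sec (Ψ x) + κA (Quotient.out (QuotientAddGroup.mk a₀ : A0bar)) = x
    have hout : κA (Quotient.out (QuotientAddGroup.mk a₀ : A0bar)) = κA a₀ := by
      apply hκA
      have h : (QuotientAddGroup.mk (Quotient.out (QuotientAddGroup.mk a₀ : A0bar)) : A0bar) = QuotientAddGroup.mk a₀ :=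
        Quotient.out_eq _
      rw [QuotientAddGroup.eq_iff_sub_mem] at h
      exact ⟨_, h, by rw [AddSubgroup.coe_subtype, AddSubgroup.coe_sub]⟩
    rw [hout, ← ha₀]; abel
  rw [← Nat.card_prod]; exact Nat.card_le_card_of_surjective Λ hΛ

end Summit.BirchSwinnertonDyer.BirchSwinnertonDyer.Theorems.GoodOrdTower

end
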